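import Summits.BirchSwinnertonDyer.Rank1Residual.X2.GreenbergVatsalSelmerEquality
import Literature.NumberTheory.EllipticCurves.GreenbergVatsal2000.LocalConditionAtP
import HarnessLib

/-!
# `Sel_{p^∞}(E/ℚ_∞) = S^{Σ₀}_{E[p^∞]}(ℚ_∞) ⊓ (conditions at Σ₀)` from the CITED local statement
# `L_𝔭 ⊆ im(κ_𝔭)` (Greenberg–Vatsal 2000 p. 26 / Greenberg 1999 Prop. 2.4)

HONEST FRAMING (cell `b2b-bsdres`, run/shared/lean/b2b/bsd-rank1-residual/, verbatim in every
file): the goal of the cell is to DELETE the COMBINATION-SHAPED residual classes of the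
Birch–Swinnerton-Dyer formula for ALL analytic-rank `≤ 1` elliptic curves over `ℚ` — "full BSD
formula for every rank `≤ 1` curve in class `C`" assembled STRICTLY from published theorems — so
that the rank-`≤ 1` remainder becomes exactly the CONSTRUCTION-SHAPED classes, which are TYPED
(missing-input `Prop`s), NOT attempted. This is not "finishing BSD". Sub-cell
`b2b-bsdres-eisenstein-p2` (CLASS-OWNERS row "X2"), gen 10: research route; NO CLAIM BEYOND STATED
CLASSES; nothing here changes a label. THEOREMS ONLY; CONDITIONAL on the Literature named fact
`GreenbergVatsal2000.imKummer_ge_greenbergCondition_at_p` (a `def … : Prop`, unproved in the tree,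
PRINTED: GV 2000 §2 p. 26 "In [Gre99], one can find a proof that `im(κ_𝔭) = L_𝔭`"; Greenberg,
LNM 1716, Props. 2.2, 2.4), taken as a hypothesis `hGV`.

WHAT. `greenbergKer_reductionData_le_localKerOver`: the named fact, instantiated at the cell's
Greenberg datum (`reductionDatum` = the instance `w = specVal v`, `red₀ = localRed` of the fact's
data, by `specVal_spec`, `localRed_apply`, `mem_reductionDatum_plus_iff`), is exactly the hypothesis
`hp` of `GreenbergVatsalSelmerEquality.selmerInfty_eq_gvSelmerInfty_inf_of_le`; hence
**`selmerInfty_eq_gvSelmerInfty_inf`**: for `E/ℚ` globally minimal, `p` odd good ORDINARY, `κ`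
cyclotomic, `Σ₀ ⊇` bad primes, `Sel_{p^∞}(E/ℚ_∞)` (dual `= D.X` of route G's `CongruentLambdaShift`)
EQUALS `S^{Σ₀}_{E[p^∞]}(ℚ_∞) ⊓ (Kummer conditions above Σ₀)` — the referee's nit
`gvSelmer-SelmerDualData-link` (R102.2 (b), R106.8) in closed form: the two groups differ by
exactly GV's local factors at `Σ₀` (`∏_{ℓ∈Σ₀} 𝓗_ℓ`, Cor. 2.3 / Prop. 2.4), everything else being
kernel theorems (gens 9–10) plus the one printed local statement at `p`.

References: Greenberg–Vatsal (2000) §2 pp. 16–17, 19, 26; Greenberg, LNM 1716 (1999) §2 pp. 69–75.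
-/

noncomputable section

open scoped Classical

namespace Summit.BirchSwinnertonDyer.Rank1Residual.X2.GreenbergVatsalSelmerEqualityCited

open NumberField IsDedekindDomain Field Literature.NumberTheory.GaloisRepresentations
  Literature.NumberTheory.EllipticCurves Literature.NumberTheory.EllipticCurves.GreenbergSelmer
  Literature.NumberTheory.EllipticCurves.GreenbergVatsal2000
  Summit.BirchSwinnertonDyer.Rank1Residual.X2.GreenbergVatsalTorsion
  Summit.BirchSwinnertonDyer.Rank1Residual.X2.GreenbergVatsalReductionDatum
  Summit.BirchSwinnertonDyer.Rank1Residual.X2.GreenbergVatsalSelmerEquality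

variable (W : WeierstrassCurve ℚ) [W.IsElliptic] [W.IsGloballyMinimal] (p : ℕ) [Fact p.Prime]
  (κ : ZpExtension ℚ p)

/-- **The cited local statement at the cell's datum**: under
`GreenbergVatsal2000.imKummer_ge_greenbergCondition_at_p` (GV p. 26 / Greenberg Prop. 2.4, PRINTED),
at the place `v ∋ p` of good ordinary reduction, Greenberg's condition for
`reductionData W p hΔ` implies the Kummer condition over `ℚ_∞^{cyc}`.
[cite: GreenbergVatsal2000, §2 p. 26] [cite: GreenbergLNM1716, §2 Props. 2.2, 2.4 (pp. 73–75)] -/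
theorem greenbergKer_reductionData_le_localKerOver (hGV : imKummer_ge_greenbergCondition_at_p)
    (hΔ : ¬ (p : ℤ) ∣ W.minimalDiscriminantInt) (hord : ¬ (p : ℤ) ∣ W.frobeniusTrace p)
    (hκ : κ.IsCyclotomic) (v : HeightOneSpectrum (𝓞 ℚ)) (hv : ((p : ℕ) : 𝓞 ℚ) ∈ v.asIdeal) :
    (reductionData W p hΔ v hv).greenbergKer κ.kerSubgroup ≤
      W.localKerOver p κ.kerSubgroup (v.adicCompletion ℚ) :=
  hGV W p hΔ hord κ hκ v hv (specVal v) (specVal_spec v) (localRed W p hv hΔ)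
    (localRed_apply W p hv hΔ) (reductionDatum W p hv hΔ) (mem_reductionDatum_plus_iff W p hv hΔ)

/-- **`Sel_{p^∞}(E/ℚ_∞) = S^{Σ₀}_{E[p^∞]}(ℚ_∞) ⊓ (Kummer conditions above Σ₀)`** for `E/ℚ` globally
minimal, `p` ODD of good ORDINARY reduction, `κ` the cyclotomic `ℤ_p`-extension, `Σ₀ ⊇` the bad
primes, Greenberg's data `C_p = ker(E[p^∞] → Ẽ)` — CONDITIONAL on the printed local statement
`imKummer_ge_greenbergCondition_at_p` (hypothesis `hGV`); all other ingredients are tree theorems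
(`selmerInfty_eq_gvSelmerInfty_inf_of_le`). [cite: GreenbergVatsal2000, §2 pp. 17, 19, 26]
[cite: GreenbergLNM1716, §2 pp. 69–75] -/
theorem selmerInfty_eq_gvSelmerInfty_inf (hGV : imKummer_ge_greenbergCondition_at_p) (hp2 : p ≠ 2)
    (hΔ : ¬ (p : ℤ) ∣ W.minimalDiscriminantInt) (hord : ¬ (p : ℤ) ∣ W.frobeniusTrace p)
    (hκ : κ.IsCyclotomic) (S₀ : Set (HeightOneSpectrum (𝓞 ℚ)))
    (hS : ∀ v : HeightOneSpectrum (𝓞 ℚ), v ∉ S₀ → ((p : ℕ) : 𝓞 ℚ) ∉ v.asIdeal →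
      W.HasGoodReductionAt v) :
    W.selmerInfty κ =
      gvSelmerInfty κ (W.geomPrimaryTorsion p) (reductionData W p hΔ) S₀ ⊓
        ⨅ (v : HeightOneSpectrum (𝓞 ℚ)) (_ : v ∈ S₀) (σ : absoluteGaloisGroup ℚ),
          (W.localKerOver p κ.kerSubgroup (v.adicCompletion ℚ)).comap
            (conjH1 κ.kerSubgroup (W.geomPrimaryTorsion p) σ) :=
  selmerInfty_eq_gvSelmerInfty_inf_of_le W p κ S₀ hp2 hΔ hκ hS
    (fun v hv ↦ greenbergKer_reductionData_le_localKerOver W p κ hGV hΔ hord hκ v hv)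

/-- Membership form of `selmerInfty_eq_gvSelmerInfty_inf`. [cite: GreenbergVatsal2000, §2 pp. 17, 19, 26] -/
theorem mem_selmerInfty_iff (hGV : imKummer_ge_greenbergCondition_at_p) (hp2 : p ≠ 2)
    (hΔ : ¬ (p : ℤ) ∣ W.minimalDiscriminantInt) (hord : ¬ (p : ℤ) ∣ W.frobeniusTrace p)
    (hκ : κ.IsCyclotomic) (S₀ : Set (HeightOneSpectrum (𝓞 ℚ)))
    (hS : ∀ v : HeightOneSpectrum (𝓞 ℚ), v ∉ S₀ → ((p : ℕ) : 𝓞 ℚ) ∉ v.asIdeal →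
      W.HasGoodReductionAt v) (c : W.subgroupH1 p κ.kerSubgroup) :
    c ∈ W.selmerInfty κ ↔
      c ∈ gvSelmerInfty κ (W.geomPrimaryTorsion p) (reductionData W p hΔ) S₀ ∧
        ∀ v ∈ S₀, ∀ σ : absoluteGaloisGroup ℚ,
          conjH1 κ.kerSubgroup (W.geomPrimaryTorsion p) σ c ∈
            W.localKerOver p κ.kerSubgroup (v.adicCompletion ℚ) :=
  mem_selmerInfty_iff_of_le W p κ S₀ hp2 hΔ hκ hS
    (fun v hv ↦ greenbergKer_reductionData_le_localKerOver W p κ hGV hΔ hord hκ v hv) c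

end Summit.BirchSwinnertonDyer.Rank1Residual.X2.GreenbergVatsalSelmerEqualityCited

end
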